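import Summits.QuantumFields.BalabanUV.Beta.FP.MixLoopPowerCounting
import Summits.QuantumFields.BalabanUV.Beta.FP.ExpLocalisedBubblePoint

/-!
# `BalabanUV.Beta.FP.MixLoopPowerCountingCubic` — road «FP» (binder row D1), remainder `ρ_n` of the H′ bookkeeping, row **RHOA-6c** «GENERIC POWER
# COUNTING OF THE MIX LOOPS», FILE C of three: the loop **(MIX-3)** `−2·tr(Q̇·Γ₀·Ḣ·𝓘)` FROM ITS LETTERS — the action∕slice 3-jet's ZERO MASS puts ONE
# difference on `Γ₀`; summed VERTEX-FIRST ([folklore] lattice bookkeeping on `ℤ⁴`; abstract kernels, every letter a displayed hypothesis; NO road object)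

HONEST DEPENDENCY (page 1, mandatory): continuum YM on T⁴ ⇐ BetaPertH ∧ nine spine estimates (0/9 proved); BetaPertH ⇐ (D1) ∧ (D4) ∧
CAP+tail; G-an2-4 gates asym, D1 and NE2/3/4.  HONEST FRAMING (cell contract, verbatim): «discharging `BetaPertH` makes Bałaban's UV
stability UNCONDITIONAL — a real constructive-QFT result; it is NOT the continuum limit and NOT the Clay problem.»  THIS MODULE is elementary
[folklore] real analysis on `ℤ⁴` over FILE A's shell engine (`MixLoopPowerCounting.sum_le_engine_of_le`), the H2-a Taylor step
`ExpLocalisedBubble.abs_sub_le_near_far_pow`, the near-box geometry `ExpLocalisedBubblePoint.quarter_bounds` ∕ `HorizontalBookkeepingTail.supNorm_le_add_of_box`,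
the exponential letters `StencilMoments.summable_of_weight_exp` ∕ `ExpKernelCalculus.Zl`, and `LatticeConvolutionBounds.sum_inv_pow_le`; it asserts nothing about
Bałaban's objects, cites nothing, mints no `Prop` fact, has no `def`, 0 sorry.  The LETTERS of `q̇` (row RHOA-6b), `𝓘` (sup letter; row IR-I), `Γ₀` (sup + first
differences; rows IR-1∕IR-Q∕IR-5) and of the cubic vertex `Ḣ` (exponential localisation + ZERO MASS; `H2V-DESIGN` §2 admissibility) are HYPOTHESES displayed in the
signatures; NOT `Mix_n = O(1)` for Bałaban's objects (row RHOA-6e assembles), NOT `hbook`, NOT D1, NOT BetaPertH, NOT continuum, NOT Clay.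

ROW (owner b2b-balaban-beta-d1-p3-g6, `RHOA-DESIGN.md` v1.1 §2bis): (MIX-3) `tr(G_CQ̇AG_CAᵀḢA) − tr(G_CQ̇PḢA)` (+ transpose twin) `= −2·tr(Q̇·Γ₀·Ḣ·𝓘)` «one
averaging 3-jet, one action∕slice 3-jet; legs `Γ₀` and `𝓘`»; letters «(Ḣ) admissible cubic family (H2V-DESIGN §2: LocStencil + ZERO MASS in each leg ⟹ it differentiates a
leg)»; power counting «(MIX-3) `k ~ n⁻³·|∇Γ₀(z)|·|𝓘| ~ n⁻³(|z|+1)⁻³` (the action 3-jet's zero mass puts ONE derivative on `Γ₀` …): `n⁻³Σ_z(|z|+1)⁻¹ ~ n⁻³·n³ = O(1)` …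
WITHOUT the 3-jet's zero mass (MIX-3) would be `O(n)`».

THE LOOP KERNEL (abstract currency of FILE A: `Pt = ℤ⁴`, `supNorm`, blocking `n ≥ 1`; `ℓ¹` size `l1` for the vertex's localisation as in `ExpLocalisedBubble`):
`k₃(b,b′) = Σ_{u∈U b} Σ_{w∈W} q̇(u;b,b+w) · T(b+w,b′,u)`, `T(c,b′,u) := Σ'_{x′} 𝓘(x′,u)·Σ'_x Γ₀(c,x)·Ḣ(b′;x,x′)` (iterated absolutely convergent sums; the second
insertion `b′` is the vertex's base point, `x` the leg joined to `Γ₀` — the ZERO-MASS leg `Σ'_x Ḣ(b′;x,x′) = 0` —, `x′` the leg joined to `𝓘`).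
HOW: §2 `abs_tsum_zeroMass_smear_le` — a one-point exponentially localised weight `ω` of zero mass against `F`: `Σ'_s ω(s)F(y+s) = Σ'_s ω(s)(F(y+s) − F(y))`, then
`abs_sub_le_near_far_pow` (near box of radius `ρ`, first differences `≤ B` there; far exponent `k`) and the exponential moments `M_m = m!e^{δ_H∕2}(2∕δ_H)^m·Zl(δ_H∕2)`;
§3 `abs_cubicLeg_le` — at `y = b′`, `F = Γ₀(c,·)`, `ρ = ⌊‖c−b′‖∕4⌋`, `k = 8`: the near box sits at distance `≥ ¾‖c−b′‖` from `c`, so `B` carries `(‖c−b′‖+1)⁻³` AND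
`e^{−(3δ∕4n)‖c−b′‖}`; the far term is `(‖c−b′‖+1)⁻⁸` (no exponential needed: summable with room); FILE D: the second moment VERTEX-FIRST: `‖b′−b‖² ≤ 2‖c−b′‖² + 2n²` and the
engine at `j = 2, 0` (`n³`, `n`) plus `Σ(‖y‖+1)^{−6}, Σ(‖y‖+1)^{−8} ≤ 81`: total `(A∕n³)·C_I·C_H·Zl(δ_H)·𝔎·n³` — EXACT power `n⁰`.  ONLY the sup letter of `𝓘` is used.

CONTENT (this file = the LEG; the second moment is FILE D `MixLoopPowerCountingCubicMoment`, split for the 400-line rule).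
* §2 `abs_tsum_zeroMass_smear_le` (generic: any base point, box radius `ρ`, far exponent `k`; summability included).
* §3 **`abs_cubicLeg_le`** (`|Σ'_x Γ₀(c,x)Ḣ(b′;x,x′)| ≤ C_H e^{−δ_H|x′−b′|₁}·(K₁·e^{−(3δ∕4n)‖c−b′‖}∕(‖c−b′‖+1)³ + K₂∕(‖c−b′‖+1)⁸)`, `K₁ = (256∕27)·C′_Γ·M₁′`,
  `K₂ = 2C_Γ·20⁸·M₈′ + (8C_Γ M₁′ + 2C_Γ M₀′)·5⁸`, summability included).
Provenance: cross-cell idle-seat kernel duty NE7b → β∕D1, unit `b2b-balaban-t4-ne7b-formalise-leaf-01` gen 23, 2026-08-21; journal INTENT ∕ CLAIM «RHOA-6c» l.23908;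
«not in print; our bookkeeping»; no existing file touched.
-/

noncomputable section

namespace Summit.QuantumFields.BalabanUV.Beta.FP.MixLoopPowerCountingCubic

open Finset Real
open scoped BigOperators
open Literature.MathematicalPhysics.QuantumFieldTheory.Balaban1983to89
open Literature.MathematicalPhysics.QuantumFieldTheory.Balaban1983to89.Beta
open B12Sec2to5 (l1 l1_nonneg)
open ExpKernelCalculus (Site Zl Zl_pos summable_exp_shift' tsum_exp_shift')
open DyadicShell (Pt supNorm supNorm_le_iff natAbs_le_supNorm)
open BlockLegs (supNorm_sub_le_real supNorm_add_le_real)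
open GradedBubbles (supNorm_neg)
open Summit.QuantumFields.BalabanUV.Beta.FP.StencilMoments (summable_of_weight_exp)
open Summit.QuantumFields.BalabanUV.Beta.FP.ExpLocalisedBubble (abs_sub_le_near_far_pow)
open Summit.QuantumFields.BalabanUV.Beta.FP.ExpLocalisedBubblePoint (quarter_bounds)
open Summit.QuantumFields.BalabanUV.Beta.FP.HorizontalBookkeepingTail (supNorm_le_add_of_box)
open Summit.QuantumFields.BalabanUV.Beta.FP.LatticeConvolutionBounds (sum_inv_pow_le)
open Summit.QuantumFields.BalabanUV.Beta.FP.MixLoopPowerCounting (sum_le_engine_of_le supNorm_cast_nonneg)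

/-! ## §2 A one-point exponentially localised weight of ZERO MASS against a kernel with first differences controlled near the base point -/

/-- **ZERO MASS PUTS ONE DIFFERENCE ON THE LEG** (abstract base point `y`, near box of radius `ρ ≥ 1`, far exponent `k`): for a weight `ω` with
`|ω s| ≤ C_ω·e^{−δ_H|s|₁}` and `Σ'_s ω s = 0`, and `F` with `|F| ≤ A₀` and first differences `≤ B` on the coordinate box of radius `ρ` around `y`,
`|Σ'_s ω(s)·F(y+s)| ≤ C_ω·(4·B·M₁ + (2A₀∕ρ^k)·M_k)`, `M_m := m!·e^{δ_H∕2}·(2∕δ_H)^m·Zl 4 (δ_H∕2)` (`ExpLocalisedBubble.abs_sub_le_near_far_pow` termwise +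
`StencilMoments.summable_of_weight_exp`). [folklore] -/
theorem abs_tsum_zeroMass_smear_le {ω F : Pt → ℝ} {y : Pt} {Cω δH A₀ B : ℝ} {ρ : ℕ} (hδH : 0 < δH) (hCω : 0 ≤ Cω)
    (hρ : 0 < ρ) (hB : 0 ≤ B) (k : ℕ) (hω : ∀ s, |ω s| ≤ Cω * Real.exp (-δH * l1 s)) (hω0 : ∑' s, ω s = 0)
    (hA : ∀ t, |F t| ≤ A₀) (hF1 : ∀ t : Pt, (∀ i, |t i - y i| ≤ (ρ : ℤ)) → ∀ i, |F (t + Pi.single i 1) - F t| ≤ B) :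
    (Summable fun s => ω s * F (y + s)) ∧
    |∑' s, ω s * F (y + s)|
      ≤ Cω * (4 * B * (((1 : ℕ).factorial : ℝ) * Real.exp (δH / 2) * (2 / δH) ^ 1 * Zl 4 (δH / 2))
          + 2 * A₀ / (ρ : ℝ) ^ k * ((k.factorial : ℝ) * Real.exp (δH / 2) * (2 / δH) ^ k * Zl 4 (δH / 2))) := by
  have hA0 : 0 ≤ A₀ := (abs_nonneg _).trans (hA y)
  have hρ' : (0 : ℝ) < ρ := by exact_mod_cast hρ
  -- summability of `ω` and of `ω·F(y+·)`
  have hω' : ∀ s, |ω s| ≤ Cω * (l1 (s - 0) + 1) ^ 0 * Real.exp (-δH * l1 (s - 0)) := fun s => by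
    rw [sub_zero, pow_zero, mul_one]; exact hω s
  have hsω : Summable ω := (summable_of_weight_exp hδH hCω hω').1
  have hsωF : Summable fun s => ω s * F (y + s) := by
    refine Summable.of_norm_bounded (hsω.abs.mul_right A₀) (fun s => ?_)
    rw [Real.norm_eq_abs, abs_mul]
    exact mul_le_mul_of_nonneg_left (hA _) (abs_nonneg _)
  refine ⟨hsωF, ?_⟩
  -- centring by the zero mass
  have e : ∑' s, ω s * F (y + s) = ∑' s, ω s * (F (y + s) - F y) := by
    have h2 : Summable fun s => ω s * F y := hsω.mul_right _
    rw [show (fun s => ω s * (F (y + s) - F y)) = fun s => ω s * F (y + s) - ω s * F y by ext s; ring,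
      hsωF.tsum_sub h2, tsum_mul_right, hω0, zero_mul, sub_zero]
  rw [e]
  -- termwise majorant: near + far
  set g₁ : Pt → ℝ := fun s => (4 * B * Cω) * (l1 (s - 0) + 1) ^ 1 * Real.exp (-δH * l1 (s - 0)) with hg₁
  set g₂ : Pt → ℝ := fun s => (2 * A₀ / (ρ : ℝ) ^ k * Cω) * (l1 (s - 0) + 1) ^ k * Real.exp (-δH * l1 (s - 0)) with hg₂
  have hmaj : ∀ s, |ω s * (F (y + s) - F y)| ≤ g₁ s + g₂ s := by
    intro s
    have hl := l1_nonneg s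
    have hd := abs_sub_le_near_far_pow (D := 4) hρ hB k hA hF1 s
    rw [abs_mul]
    calc |ω s| * |F (y + s) - F y| ≤ (Cω * Real.exp (-δH * l1 s)) * ((4 : ℕ) * B * l1 s + 2 * A₀ * (l1 s / ρ) ^ k) :=
          mul_le_mul (hω s) hd (abs_nonneg _) (by positivity)
      _ ≤ (Cω * Real.exp (-δH * l1 s)) * (4 * B * (l1 s + 1) ^ 1 + 2 * A₀ / (ρ : ℝ) ^ k * (l1 s + 1) ^ k) := by
          refine mul_le_mul_of_nonneg_left ?_ (by positivity)
          push_cast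
          rw [pow_one, div_pow, show 2 * A₀ / (ρ : ℝ) ^ k * (l1 s + 1) ^ k = 2 * A₀ * ((l1 s + 1) ^ k / (ρ : ℝ) ^ k) by ring]
          gcongr <;> linarith
      _ = g₁ s + g₂ s := by simp only [hg₁, hg₂, sub_zero]; ring
  have hG₁ := summable_of_weight_exp (k := 1) (q := (0 : Pt)) hδH (show 0 ≤ 4 * B * Cω by positivity)
    (g := g₁) (fun s => by rw [hg₁]; exact le_of_eq (abs_of_nonneg (by have := l1_nonneg (s - 0); positivity)))
  have hG₂ := summable_of_weight_exp (k := k) (q := (0 : Pt)) hδH (show 0 ≤ 2 * A₀ / (ρ : ℝ) ^ k * Cω by positivity)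
    (g := g₂) (fun s => by rw [hg₂]; exact le_of_eq (abs_of_nonneg (by have := l1_nonneg (s - 0); positivity)))
  have hg₁0 : ∀ s, 0 ≤ g₁ s := fun s => by rw [hg₁]; have := l1_nonneg (s - 0); positivity
  have hg₂0 : ∀ s, 0 ≤ g₂ s := fun s => by rw [hg₂]; have := l1_nonneg (s - 0); positivity
  have e1 : ∑' s, |g₁ s| = ∑' s, g₁ s := tsum_congr fun s => abs_of_nonneg (hg₁0 s)
  have e2 : ∑' s, |g₂ s| = ∑' s, g₂ s := tsum_congr fun s => abs_of_nonneg (hg₂0 s)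
  have HM : HasSum (fun s => g₁ s + g₂ s) ((∑' s, g₁ s) + ∑' s, g₂ s) := hG₁.1.hasSum.add hG₂.1.hasSum
  have hb : ‖∑' s, ω s * (F (y + s) - F y)‖ ≤ (∑' s, g₁ s) + ∑' s, g₂ s :=
    tsum_of_norm_bounded HM (fun s => by rw [Real.norm_eq_abs]; exact hmaj s)
  rw [Real.norm_eq_abs] at hb
  refine hb.trans ?_
  rw [← e1, ← e2]
  calc (∑' s, |g₁ s|) + ∑' s, |g₂ s|
      ≤ 4 * B * Cω * (((1 : ℕ).factorial : ℝ) * Real.exp (δH / 2) * (2 / δH) ^ 1) * Zl 4 (δH / 2)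
        + 2 * A₀ / (ρ : ℝ) ^ k * Cω * ((k.factorial : ℝ) * Real.exp (δH / 2) * (2 / δH) ^ k) * Zl 4 (δH / 2) := add_le_add hG₁.2 hG₂.2
    _ = _ := by ring


/-! ## §3 The cubic-vertex leg: `Σ'_x Γ₀(c,x)·Ḣ(b′;x,x′)` decays like `(‖c−b′‖+1)⁻³e^{−(3δ∕4n)‖c−b′‖} + (‖c−b′‖+1)⁻⁸` -/

section Cubic

variable {Γ : Pt → Pt → ℝ} {H : Pt → Pt → Pt → ℝ} {C_Γ C_Γ' C_H δ δH : ℝ} {n : ℕ}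

/-- **THE CUBIC-VERTEX LEG** (zero mass ⟹ one difference on `Γ₀`; near box `ρ = ⌊‖c−b′‖∕4⌋` at distance `≥ ¾‖c−b′‖` from `c`, far exponent `8`; separations `< 4`
through the crude box `ρ = 1`, `B = 2C_Γ`, `k = 0`): with `M₀′ = e^{δ_H∕2}Zl(δ_H∕2)`, `M₁′ = e^{δ_H∕2}(2∕δ_H)Zl(δ_H∕2)`, `M₈′ = 8!·e^{δ_H∕2}(2∕δ_H)⁸Zl(δ_H∕2)`,
`|Σ'_x Γ₀(c,x)Ḣ(b′;x,x′)| ≤ C_H e^{−δ_H|x′−b′|₁}·((256∕27)C′_Γ M₁′·e^{−(¾δ∕n)‖c−b′‖}∕(‖c−b′‖+1)³ + (2C_Γ·20⁸·M₈′ + (8C_Γ M₁′ + 2C_Γ M₀′)·5⁸)∕(‖c−b′‖+1)⁸)`. [folklore] -/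
theorem abs_cubicLeg_le (hδ : 0 < δ) (hδH : 0 < δH) (hn : 1 ≤ n) (hΓ0 : ∀ c x, |Γ c x| ≤ C_Γ)
    (hΓ1 : ∀ c t (i : Fin 4), |Γ c (t + Pi.single i 1) - Γ c t|
      ≤ C_Γ' / ((supNorm (c - t) : ℝ) + 1) ^ 3 * Real.exp (-(δ / n) * (supNorm (c - t) : ℝ)))
    (hH : ∀ b' x x', |H b' x x'| ≤ C_H * Real.exp (-δH * l1 (x - b')) * Real.exp (-δH * l1 (x' - b')))
    (hH0 : ∀ b' x', ∑' x, H b' x x' = 0) (c b' x' : Pt) :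
    (Summable fun x => Γ c x * H b' x x') ∧
    |∑' x, Γ c x * H b' x x'|
      ≤ C_H * Real.exp (-δH * l1 (x' - b')) *
        ((256 / 27 * C_Γ' * (Real.exp (δH / 2) * (2 / δH) * Zl 4 (δH / 2)))
            * (Real.exp (-(3 * δ / 4 / n) * (supNorm (c - b') : ℝ)) / ((supNorm (c - b') : ℝ) + 1) ^ 3)
          + (2 * C_Γ * 20 ^ 8 * (40320 * Real.exp (δH / 2) * (2 / δH) ^ 8 * Zl 4 (δH / 2))
              + (8 * C_Γ * (Real.exp (δH / 2) * (2 / δH) * Zl 4 (δH / 2)) + 2 * C_Γ * (Real.exp (δH / 2) * Zl 4 (δH / 2))) * 5 ^ 8)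
            / ((supNorm (c - b') : ℝ) + 1) ^ 8) := by
  -- abbreviations
  set r : ℕ := supNorm (c - b') with hr
  set M₀ : ℝ := Real.exp (δH / 2) * Zl 4 (δH / 2) with hM₀
  set M₁ : ℝ := Real.exp (δH / 2) * (2 / δH) * Zl 4 (δH / 2) with hM₁
  set M₈ : ℝ := 40320 * Real.exp (δH / 2) * (2 / δH) ^ 8 * Zl 4 (δH / 2) with hM₈
  have hZ : 0 < Zl 4 (δH / 2) := Zl_pos (half_pos hδH)
  have hM₀0 : 0 ≤ M₀ := by positivity
  have hM₁0 : 0 ≤ M₁ := by positivity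
  have hM₈0 : 0 ≤ M₈ := by positivity
  have hCH : 0 ≤ C_H := by
    have h := hH b' b' b'
    rw [sub_self, show l1 (0 : Pt) = 0 by unfold l1; simp, mul_zero, Real.exp_zero, mul_one, mul_one] at h
    exact (abs_nonneg _).trans h
  have hCΓ : 0 ≤ C_Γ := (abs_nonneg _).trans (hΓ0 c c)
  have hCΓ' : 0 ≤ C_Γ' := by
    have h := hΓ1 c c 0
    rw [sub_self, show supNorm (0 : Pt) = 0 from DyadicShell.supNorm_eq_zero_iff.mpr rfl] at h
    norm_num at h
    exact (abs_nonneg _).trans h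
  have hr0 : (0 : ℝ) ≤ (r : ℝ) := Nat.cast_nonneg r
  have hr1 : (0 : ℝ) < (r : ℝ) + 1 := by positivity
  -- the weight in the vertex variable `s = x − b′`
  set Cω : ℝ := C_H * Real.exp (-δH * l1 (x' - b')) with hCω
  have hCω0 : 0 ≤ Cω := by positivity
  set ω : Pt → ℝ := fun s => H b' (b' + s) x' with hω
  have hωb : ∀ s, |ω s| ≤ Cω * Real.exp (-δH * l1 s) := fun s => by
    have h := hH b' (b' + s) x'
    rw [add_sub_cancel_left] at h
    rw [hω, hCω]
    linarith [h]
  have hω0 : ∑' s, ω s = 0 := by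
    have h := (Equiv.addLeft b').tsum_eq (fun x => H b' x x')
    simp only [Equiv.coe_addLeft] at h
    rw [hω]
    exact h.trans (hH0 b' x')
  -- shift `x = b′ + s`
  have hshift : ∑' x, Γ c x * H b' x x' = ∑' s, ω s * Γ c (b' + s) := by
    have h := (Equiv.addLeft b').tsum_eq (fun x => Γ c x * H b' x x')
    simp only [Equiv.coe_addLeft] at h
    rw [← h]
    exact tsum_congr fun s => by simp only [hω]; ring
  have hF0 : ∀ t, |Γ c t| ≤ C_Γ := hΓ0 c
  -- the two applications of §2
  -- (i) crude: ρ = 1, B = 2C_Γ, k = 0 (all separations)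
  have hcrude := abs_tsum_zeroMass_smear_le (F := Γ c) (y := b') hδH hCω0 Nat.one_pos (show 0 ≤ 2 * C_Γ by positivity) 0 hωb hω0
    hF0 (fun t _ i => by
      calc |Γ c (t + Pi.single i 1) - Γ c t| ≤ |Γ c (t + Pi.single i 1)| + |Γ c t| := abs_sub _ _
        _ ≤ C_Γ + C_Γ := add_le_add (hF0 _) (hF0 _)
        _ = 2 * C_Γ := by ring)
  have hsumm : Summable fun x => Γ c x * H b' x x' := by
    have h' : Summable ((fun x => Γ c x * H b' x x') ∘ (Equiv.addLeft b')) :=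
      hcrude.1.congr fun s => by simp only [hω, Function.comp_apply, Equiv.coe_addLeft]; ring
    exact (Equiv.addLeft b').summable_iff.mp h'
  refine ⟨hsumm, ?_⟩
  rw [hshift]
  -- target constants
  set K₁ : ℝ := 256 / 27 * C_Γ' * M₁ with hK₁
  set K₂ : ℝ := 2 * C_Γ * 20 ^ 8 * M₈ + (8 * C_Γ * M₁ + 2 * C_Γ * M₀) * 5 ^ 8 with hK₂
  set E : ℝ := Real.exp (-(3 * δ / 4 / n) * (r : ℝ)) with hE
  have hE0 : 0 < E := Real.exp_pos _
  have hK₁0 : 0 ≤ K₁ := by positivity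
  show |∑' s, ω s * Γ c (b' + s)| ≤ Cω * (K₁ * (E / ((r : ℝ) + 1) ^ 3) + K₂ / ((r : ℝ) + 1) ^ 8)
  by_cases h4 : 4 ≤ r
  · -- (ii) OUTER: ρ = ⌊r/4⌋, B with the exponential, k = 8
    obtain ⟨hρ1, hρ4, hρ16⟩ := quarter_bounds h4
    set ρ : ℕ := r / 4 with hρ
    have hρpos : (0 : ℝ) < ρ := by exact_mod_cast hρ1
    have hρ4' : 4 * (ρ : ℝ) ≤ r := by exact_mod_cast hρ4
    have hρ20 : (r : ℝ) + 1 ≤ 20 * ρ := by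
      have : (r : ℝ) ≤ 16 * ρ := by exact_mod_cast hρ16
      have : (1 : ℝ) ≤ ρ := by exact_mod_cast hρ1
      linarith
    set B : ℝ := (4 / 3) ^ 3 * C_Γ' * (E / ((r : ℝ) + 1) ^ 3) with hB
    have hB0 : 0 ≤ B := by positivity
    have hF1 : ∀ t : Pt, (∀ i, |t i - b' i| ≤ (ρ : ℤ)) → ∀ i, |Γ c (t + Pi.single i 1) - Γ c t| ≤ B := by
      intro t ht i
      -- geometry: ‖c − t‖ ≥ ¾ r
      have hbox : supNorm (c - b') ≤ supNorm (c - t) + ρ :=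
        supNorm_le_add_of_box (t := c - t) (y := c - b') fun j => by
          have e : (c - t) j - (c - b') j = -(t j - b' j) := by simp only [Pi.sub_apply]; ring
          rw [e, abs_neg]; exact ht j
      have hct : (3 / 4 : ℝ) * r ≤ (supNorm (c - t) : ℝ) := by
        have : (r : ℝ) ≤ (supNorm (c - t) : ℝ) + ρ := by rw [hr]; exact_mod_cast hbox
        linarith
      have hs0 := supNorm_cast_nonneg (c - t)
      have hs1 : (0 : ℝ) < (supNorm (c - t) : ℝ) + 1 := by linarith
      refine (hΓ1 c t i).trans ?_
      rw [hB]
      have hexp : Real.exp (-(δ / n) * (supNorm (c - t) : ℝ)) ≤ E := by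
        rw [hE]; apply Real.exp_le_exp.mpr
        have hdn : 0 < δ / n := div_pos hδ (by exact_mod_cast hn)
        have : -(3 * δ / 4 / n) * (r : ℝ) = -(δ / n) * ((3 / 4 : ℝ) * r) := by ring
        rw [this]
        exact mul_le_mul_of_nonpos_left hct (by linarith)
      have hpow : C_Γ' / ((supNorm (c - t) : ℝ) + 1) ^ 3 ≤ (4 / 3) ^ 3 * C_Γ' * (1 / ((r : ℝ) + 1) ^ 3) := by
        rw [mul_one_div, div_le_div_iff₀ (pow_pos hs1 3) (pow_pos hr1 3)]
        have h3 : ((r : ℝ) + 1) ^ 3 ≤ ((4 / 3 : ℝ) * ((supNorm (c - t) : ℝ) + 1)) ^ 3 := by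
          apply pow_le_pow_left₀ hr1.le; linarith
        calc C_Γ' * ((r : ℝ) + 1) ^ 3 ≤ C_Γ' * ((4 / 3 : ℝ) * ((supNorm (c - t) : ℝ) + 1)) ^ 3 := mul_le_mul_of_nonneg_left h3 hCΓ'
          _ = (4 / 3) ^ 3 * C_Γ' * ((supNorm (c - t) : ℝ) + 1) ^ 3 := by ring
      calc C_Γ' / ((supNorm (c - t) : ℝ) + 1) ^ 3 * Real.exp (-(δ / n) * (supNorm (c - t) : ℝ))
          ≤ ((4 / 3) ^ 3 * C_Γ' * (1 / ((r : ℝ) + 1) ^ 3)) * E := mul_le_mul hpow hexp (Real.exp_pos _).le (by positivity)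
        _ = (4 / 3) ^ 3 * C_Γ' * (E / ((r : ℝ) + 1) ^ 3) := by ring
    have hout := (abs_tsum_zeroMass_smear_le (F := Γ c) (y := b') hδH hCω0 hρ1 hB0 8 hωb hω0 hF0 hF1).2
    refine hout.trans ?_
    have hfar : 2 * C_Γ / (ρ : ℝ) ^ 8 ≤ 2 * C_Γ * 20 ^ 8 * (1 / ((r : ℝ) + 1) ^ 8) := by
      rw [mul_one_div, div_le_div_iff₀ (pow_pos hρpos 8) (pow_pos hr1 8)]
      have h8 : ((r : ℝ) + 1) ^ 8 ≤ (20 * (ρ : ℝ)) ^ 8 := pow_le_pow_left₀ hr1.le hρ20 8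
      calc 2 * C_Γ * ((r : ℝ) + 1) ^ 8 ≤ 2 * C_Γ * (20 * (ρ : ℝ)) ^ 8 := mul_le_mul_of_nonneg_left h8 (by positivity)
        _ = 2 * C_Γ * 20 ^ 8 * (ρ : ℝ) ^ 8 := by ring
    have e1 : ((1 : ℕ).factorial : ℝ) * Real.exp (δH / 2) * (2 / δH) ^ 1 * Zl 4 (δH / 2) = M₁ := by rw [hM₁]; norm_num [Nat.factorial]
    have e8 : ((8 : ℕ).factorial : ℝ) * Real.exp (δH / 2) * (2 / δH) ^ 8 * Zl 4 (δH / 2) = M₈ := by rw [hM₈]; norm_num [Nat.factorial]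
    rw [e1, e8]
    have hK₂ge : 2 * C_Γ * 20 ^ 8 * (1 / ((r : ℝ) + 1) ^ 8) * M₈ ≤ K₂ / ((r : ℝ) + 1) ^ 8 := by
      rw [hK₂, add_div]
      have : 0 ≤ (8 * C_Γ * M₁ + 2 * C_Γ * M₀) * 5 ^ 8 / ((r : ℝ) + 1) ^ 8 := by positivity
      have e : 2 * C_Γ * 20 ^ 8 * (1 / ((r : ℝ) + 1) ^ 8) * M₈ = 2 * C_Γ * 20 ^ 8 * M₈ / ((r : ℝ) + 1) ^ 8 := by ring
      linarith
    calc Cω * (4 * B * M₁ + 2 * C_Γ / (ρ : ℝ) ^ 8 * M₈)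
        ≤ Cω * (4 * B * M₁ + 2 * C_Γ * 20 ^ 8 * (1 / ((r : ℝ) + 1) ^ 8) * M₈) := by gcongr
      _ = Cω * (K₁ * (E / ((r : ℝ) + 1) ^ 3) + 2 * C_Γ * 20 ^ 8 * (1 / ((r : ℝ) + 1) ^ 8) * M₈) := by rw [hB, hK₁]; ring
      _ ≤ Cω * (K₁ * (E / ((r : ℝ) + 1) ^ 3) + K₂ / ((r : ℝ) + 1) ^ 8) := by gcongr
  · -- CORE: r ≤ 3, the crude bound, `1 ≤ 5⁸/(r+1)⁸`
    have hr3 : (r : ℝ) + 1 ≤ 5 := by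
      have : r ≤ 3 := by omega
      have : (r : ℝ) ≤ 3 := by exact_mod_cast this
      linarith
    have hcr := hcrude.2
    have e1 : ((1 : ℕ).factorial : ℝ) * Real.exp (δH / 2) * (2 / δH) ^ 1 * Zl 4 (δH / 2) = M₁ := by rw [hM₁]; norm_num [Nat.factorial]
    have e0 : ((0 : ℕ).factorial : ℝ) * Real.exp (δH / 2) * (2 / δH) ^ 0 * Zl 4 (δH / 2) = M₀ := by rw [hM₀]; norm_num [Nat.factorial]
    rw [e1, e0] at hcr
    norm_num at hcr
    refine hcr.trans ?_
    have h58 : (1 : ℝ) ≤ 5 ^ 8 / ((r : ℝ) + 1) ^ 8 := by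
      rw [le_div_iff₀ (pow_pos hr1 8), one_mul]
      exact pow_le_pow_left₀ hr1.le hr3 8
    have hcore : 4 * (2 * C_Γ) * M₁ + 2 * C_Γ * M₀ ≤ K₂ / ((r : ℝ) + 1) ^ 8 := by
      have hx : 0 ≤ 8 * C_Γ * M₁ + 2 * C_Γ * M₀ := by positivity
      have h1 : 8 * C_Γ * M₁ + 2 * C_Γ * M₀ ≤ (8 * C_Γ * M₁ + 2 * C_Γ * M₀) * (5 ^ 8 / ((r : ℝ) + 1) ^ 8) := by
        nlinarith
      have h2 : 0 ≤ 2 * C_Γ * 20 ^ 8 * M₈ / ((r : ℝ) + 1) ^ 8 := by positivity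
      rw [hK₂, add_div]
      have e : (8 * C_Γ * M₁ + 2 * C_Γ * M₀) * (5 ^ 8 / ((r : ℝ) + 1) ^ 8) = (8 * C_Γ * M₁ + 2 * C_Γ * M₀) * 5 ^ 8 / ((r : ℝ) + 1) ^ 8 := by
        ring
      linarith
    have hnear : 0 ≤ K₁ * (E / ((r : ℝ) + 1) ^ 3) := by positivity
    calc Cω * (4 * (2 * C_Γ) * M₁ + 2 * C_Γ * M₀) ≤ Cω * (K₂ / ((r : ℝ) + 1) ^ 8) := mul_le_mul_of_nonneg_left hcore hCω0
      _ ≤ Cω * (K₁ * (E / ((r : ℝ) + 1) ^ 3) + K₂ / ((r : ℝ) + 1) ^ 8) := by gcongr; linarith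

end Cubic

end Summit.QuantumFields.BalabanUV.Beta.FP.MixLoopPowerCountingCubic

end
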